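import Literature.AnabelianGeometry.SemiGraphs.ArithTemperedGroupTopology

/-!
# [SemiAnbd] Prop 5.2 (iv), tempered topology on `π₁^temp(𝒢) ⋊^out Π_A`: NON-VACUITY of the package —
# the split case (trivial arithmetic component) inhabits it for every chart

Mochizuki, *Semi-graphs of anabelioids*, Publ. RIMS **42** (2006) 221–322, Def 5.1 (i) p. 62, Prop 5.2 (iv)
p. 64 [cite: MochizukiSemiAnbd2006, Prop 5.2 (iv), p. 64].

PROOF-ONLY certificate (row T54-B-top, `HOME/plan/GAP-LEDGER.md` G-w4d053-1; seat abc-iut-L3-d2): the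
hypotheses of `ProfiniteSemiGraph.exists_arithTemperedGroup_of_kernelSeq` (algebraic half abc-iut-w4-d082
+ topological half abc-iut-L3-d2) are JOINTLY SATISFIABLE over every `𝒢` with the Prop 3.6 hypotheses and
every tempered chart `c`: take the trivial base of constants `Π_A = 1` (`PUnit`), the trivial outer action
and base action (then `hV`/`hE`/`hopen` hold with the representative `1`, as in abc-iut-w4-d098's audit
of p416276), and the kernel sequence `K n := ι(N n)` for an antitone basis `N n` of open normal subgroups
of `π₁^temp(𝒢)` (tempered + Galois-countable).  So the package asserts nothing contradictory, and in the
split case it returns `π₁^temp(𝒢)` itself with its tempered topology (`ι` a closed embedding onto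
`Gtp`, `aug` trivial).

* `exists_arithTemperedGroup_split` — the literal conclusion of `exists_arithTemperedGroup_of_kernelSeq`
  at `Π_A = PUnit`, `ρ = 1`, `baseAct = 1`, for every `(𝒢, h36, c)`.

Nothing here refers to the IUT corpus; no side is taken on [IUTchIII] Cor 3.12; typed ≠ proved.
-/

namespace Literature.AnabelianGeometry.SemiGraphs

namespace ProfiniteSemiGraph

open Literature.AnabelianGeometry.EtaleTheta CategoryTheory Topology Filter

universe u

variable {𝒢 : ProfiniteSemiGraph.{u}} (c : TemperedPiChart 𝒢)

/-- The identity automorphism of a semi-graph. [folklore] -/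
private theorem aut_one_hom'' (X : SemiGraph.{u}) : (1 : Aut X).hom = 𝟙 X := rfl

/-- The identity bi-continuous automorphism maps a subgroup to itself. [folklore] -/
private theorem map_one_contMulAut' (H : Subgroup c.G) :
    H.map ((1 : contMulAut c.G) : MulAut c.G).toMonoidHom = H := by
  ext x
  simp [Subgroup.mem_map]

/-- **Non-vacuity of the T54-B package (split case)**: for every `𝒢` under the Prop 3.6 hypotheses and
every tempered chart `c`, with trivial base of constants `Π_A = 1`, trivial outer action and trivial base
action, the hypotheses of `exists_arithTemperedGroup_of_kernelSeq` are met (kernel sequence = the image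
of an antitone basis of open normal subgroups of `π₁^temp(𝒢)`), so a TEMPERED arithmetic group with the
chart action exists — namely `π₁^temp(𝒢)` itself. [cite: MochizukiSemiAnbd2006, Prop 5.2 (iv), p. 64] -/
theorem exists_arithTemperedGroup_split (h36 : 𝒢.Prop36Hypotheses) :
    ∃ (Gtp : Type u) (_ : Group Gtp) (_ : TopologicalSpace Gtp) (_ : IsTopologicalGroup Gtp)
      (ι : c.G →ₜ* Gtp) (aug : Gtp →ₜ* PUnit.{u+1}),
      Function.Injective ι ∧ ι.toMonoidHom.range = aug.toMonoidHom.ker ∧ Function.Surjective aug ∧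
      IsTempered Gtp ∧ IsEmbedding ι ∧ IsClosed (Set.range ι) ∧ IsOpenMap aug ∧
      ArithChartAction c ι.toMonoidHom aug.toMonoidHom
        (fun a v => ((1 : PUnit.{u+1} →* Aut 𝒢.graph) a).hom.vertexMap v)
        (fun a e => ((1 : PUnit.{u+1} →* Aut 𝒢.graph) a).hom.edgeMap e)
        (fun a b => ((1 : PUnit.{u+1} →* Aut 𝒢.graph) a).hom.branchMap b) := by
  classical
  -- the trivial base of constants is tempered (profinite)
  haveI : IsTopologicalGroup PUnit.{u+1} :=
    { continuous_mul := continuous_of_discreteTopology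
      continuous_inv := continuous_of_discreteTopology }
  have hA : IsTempered PUnit.{u+1} := IsTempered.of_profinite
  -- the outer semi-direct product with the trivial group: `ι` is bijective
  let ρ : PUnit.{u+1} →* TopOut c.G := 1
  obtain ⟨hinj, hex, -⟩ := outerAction_exact c ρ h36
  have hsurjι : Function.Surjective (toOuterSemidirectProduct ρ) := by
    intro e
    have he : e ∈ (outerSemidirectProductSnd ρ).ker := Subsingleton.elim _ _
    rw [← hex] at he
    exact he
  -- an antitone basis of open normal subgroups of the Galois-countable tempered `π₁^temp(𝒢)`
  haveI := c.secondCountableTopology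
  obtain ⟨N, -, hN⟩ := c.isTempered.hasBasis_nhds_one.exists_antitone_subbasis
  let K : ℕ → Subgroup (outerSemidirectProduct ρ) :=
    fun n => (N n).toSubgroup.map (toOuterSemidirectProduct ρ)
  have hcomap : ∀ n, (K n).comap (toOuterSemidirectProduct ρ) = (N n).toSubgroup := fun n =>
    Subgroup.comap_map_eq_self_of_injective hinj _
  have hanti : Antitone K := fun n m hnm =>
    Subgroup.map_mono (SetLike.coe_subset_coe.mp (hN.antitone hnm))
  have hnormal : ∀ n, (K n).Normal := fun n =>
    Subgroup.Normal.map inferInstance _ hsurjι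
  have hK1 : ∀ n, IsOpen (((K n).comap (toOuterSemidirectProduct ρ) : Subgroup c.G) : Set c.G) :=
    fun n => by rw [hcomap]; exact (N n).toOpenSubgroup.isOpen
  have hK1' : ∀ n, IsOpen (((K n).map (outerSemidirectProductSnd ρ) : Subgroup PUnit.{u+1}) :
      Set PUnit.{u+1}) := fun n => isOpen_discrete _
  have hK3 : ∀ U ∈ 𝓝 (1 : c.G), ∃ n,
      (((K n).comap (toOuterSemidirectProduct ρ) : Subgroup c.G) : Set c.G) ⊆ U := by
    intro U hU
    obtain ⟨n, hn⟩ := hN.mem_iff.mp hU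
    exact ⟨n, by rw [hcomap]; exact hn⟩
  exact exists_arithTemperedGroup_of_kernelSeq c ρ 1 h36 hA
    (fun a v H hH => ⟨1, by simp [ρ], by rw [map_one_contMulAut']; simpa [aut_one_hom''] using hH⟩)
    (fun a e L hL => ⟨1, by simp [ρ], by rw [map_one_contMulAut']; simpa [aut_one_hom''] using hL⟩)
    ⟨⊤, by rw [Subgroup.coe_top]; exact isOpen_univ, fun a _ => by simp [aut_one_hom'']⟩
    K hanti hnormal hK1 hK1' hK3

end ProfiniteSemiGraph

end Literature.AnabelianGeometry.SemiGraphs
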